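import Mathlib
import HarnessLib
import Summits.HubbardSuperconductivity.HubbardSuperconductivity.Theorems.KLProgrammeKLRegimeEngineV8E5BlockHybridTails
import Summits.HubbardSuperconductivity.HubbardSuperconductivity.Theorems.KLProgrammeKLRegimeWickMixedContraction

/-!
# Route `KLProgramme` — ENGINE child gen 8 (stmt-HubbardSuperconductivity-20437 `KLRegimeEngineV17F2`), SKELETON v2 class #3, PROVING side:
# the HYBRID tails of the E.5 block with a RESCALED line `0` — keeping the derivative line's Gram half-norm out of the envelope's base
# (cell gate-hubbard-kl, seat p5 g8; sequel to `…EngineV8E5BlockHybridTails`)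

WHY.  The tails of `…E5BlockHybridTails` key the Gram data by the two-symbol FAMILY `{s₀, s₁}`, so the envelope's base is `Σ_t κ_t² = κ_{s₀}² + κ_{s₁}²`, although
only the soft symbol `s₁` ever sits on a Gram line.  The block's line `0` is the slice DERIVATIVE `Ċ_Λ` per unit `Λ`: its Gram half-norm is `κ_{s₀}² ≍ 2^{−n}`
against the soft line's `κ_{s₁}² ≍ e₀·8^{−n}`, which would spoil the geometric envelope (`x′ ≍ Klam·U·4^n`) at deep scales.  The block is LINEAR in line `0`
(`kernel((Δ_×(SᵀDS))^i·Δ_×(Sᵀ(λĊ)S))(…) = λ·kernel((Δ_×(SᵀDS))^i·Δ_×(SᵀĊS))(…)`, `crossCov_smul` + `grassmannLaplacian_smul`), so one presents line `0` through the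
RESCALED symbol `λ·ṡ` with `λ ≍ Λ_{n−1} − Λ_n` (then `κ_{s₀}² ≍ 3e₀·8^{−n}`, same order as `κ_{s₁}²`, and `α ↦ λα`) and divides by `λ` at the end:

* `kernel_pow_mul_crossLaplacian_smul_line` — homogeneity of the two-vertex `i`-line term in line `0`;
* **`klE5_hybridTail_le_of_lineData_scaled`** / **`…_of_b`** — `klE5_hybridTail_le_of_lineData(_of_b)` with `normalCovariance (sym s₀) = (λ:ℂ)•Ċ_Λ`, `0 < λ`:
  the UNSCALED tail is `≤ λ⁻¹·((m₀+m₁+5)!/(4!(1−x′)^{m₀+m₁+6}))·(α·(δ·4ρ₀)²·A)` with `α`, `κ` those of the scaled line;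
* **`…_pointAugment_scaled`** / **`…_of_b`** — the same for the point-augmented pair (the form the instance of record `norm_klE5Block_le_of_hybridTails_klAniso` reads).

Pure composition; no definitions, no named facts, nothing about the model's sizes is asserted; nothing asserts superconductivity.
-/

noncomputable section

namespace Summit.HubbardSuperconductivity.HubbardSuperconductivity.Theorems.KLRegimeSplit

set_option linter.dupNamespace false -- summit = problem name (single-conjunct summit), D-0017

open Real Finset Literature.MathematicalPhysics.QuantumLattice Literature.Probability.LatticeModels GrassmannAlgebra Matrix
open Literature.MathematicalPhysics.QuantumLattice.FermiRG
open Summit.HubbardSuperconductivity.HubbardSuperconductivity.Theorems.KLRegimeWick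
open Summit.HubbardSuperconductivity.HubbardSuperconductivity.Theorems.EngineV8

/-! ## §1 Homogeneity of the two-vertex term in line `0` -/

section Homogeneity

variable {Γ Γ' : Type*} [Fintype Γ] [DecidableEq Γ] [Fintype Γ'] [DecidableEq Γ']

omit [DecidableEq Γ] [DecidableEq Γ'] in
/-- **The `i`-line two-vertex term is linear in line `0`**: rescaling the line-`0` covariance by `λ` rescales every kernel by `λ`. [folklore] -/
theorem kernel_pow_mul_crossLaplacian_smul_line (S : Matrix Γ' Γ ℂ) (D C : Matrix Γ' Γ' ℂ) (c : ℂ) (i : ℕ) (y : GrassmannAlgebra ℂ (Γ × Fin 2))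
    (m : ℕ) (Z : Fin m → Γ × Fin 2) :
    kernel ℂ ((grassmannLaplacian ℂ (crossCov ℂ (S.transpose * D * S)) ^ i * grassmannLaplacian ℂ (crossCov ℂ (S.transpose * (c • C) * S))) y) m Z =
      c * kernel ℂ ((grassmannLaplacian ℂ (crossCov ℂ (S.transpose * D * S)) ^ i * grassmannLaplacian ℂ (crossCov ℂ (S.transpose * C * S))) y) m Z := by
  rw [Matrix.mul_smul, Matrix.smul_mul, crossCov_smul, grassmannLaplacian_smul, Module.End.mul_apply, Module.End.mul_apply, LinearMap.smul_apply,
    map_smul, kernel_smul]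

end Homogeneity

/-! ## §2 The HYBRID tails of the block with a rescaled line `0` (generic pair) -/

section Scaled

variable {L M N : ℕ} [NeZero L] (β μ : ℝ) (K : TrigPolyC4v) (n₀ : ℕ) (κ : FreqMomentum L M × Fin 2 → ℂ)
  (V : HubbardGrassmann L M) (Λ : ℝ) {ι : Type*} [Fintype ι] [DecidableEq ι]

/-- **`klE5_hybridTail_le_of_lineData` with line `0` presented by a RESCALED symbol** (`normalCovariance (sym s₀) = λ•Ċ_Λ`, `0 < λ`; `α`, `κ s₀` are those of
the scaled line): the UNSCALED tail is at most `λ⁻¹·((m₀+m₁+5)!/(4!(1−x)^{m₀+m₁+6}))·(α·(δ·4ρ₀)²·A)`. [cite: BenfattoGiulianiMastropietro2006, §2.8 (2.80)] -/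
theorem klE5_hybridTail_le_of_lineData_scaled {m₀ m₁ : ℕ} (hβ : 0 ≤ β) (F Ft : Fin N → FreqMomentum L M → ℂ)
    {ρ₀ : ℕ} (hρ₀ : ∀ ω : Fin N, ((univ : Finset (Fin N)).filter fun ω' => ∃ q, Ft ω q * Ft ω' q ≠ 0).card ≤ ρ₀)
    (sym : ι → FreqMomentum L M × Fin 2 → ℂ) (s₀ s₁ : ι) {lam : ℝ} (hlam : 0 < lam)
    (hs₀ : normalCovariance L M (sym s₀) = (lam : ℂ) • klE5DressedSliceDeriv L M β μ K n₀ κ Λ)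
    (hs₁ : normalCovariance L M (sym s₁) = klE5Total L M β μ K n₀ κ - klE5DressedSlice L M β μ K n₀ κ Λ)
    (κg : ι → ℝ)
    (hκF : ∀ (t : ι) (Y : SpaceTimeIdx L M × SectorLeg N), Y.2.2 = 0 → ‖sectorGramF L M β Ft (sym t) Y‖ ≤ κg t)
    (hκG : ∀ (t : ι) (Y : SpaceTimeIdx L M × SectorLeg N), Y.2.2 = 1 → ‖sectorGramG L M β Ft (sym t) Y‖ ≤ κg t)
    (s : Fin 4 → Fin 2) (hm₀ : (univ.filter fun i => s i = 0).card = m₀ + 1) (hm₁ : (univ.filter fun i => s i = 1).card = m₁)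
    (p : Fin 4) (hp : s p = 0) (z : SpaceTimeIdx L M × SectorLeg N) (Ωo : Fin 4 → SectorLeg N) {α : ℝ} (hα : 0 ≤ α)
    (hrow : ∀ X, ∑ Y, ‖((sectorSubMatrix L M β Ft).transpose * normalCovariance L M (sym s₀) * sectorSubMatrix L M β Ft) X Y‖ ≤ α)
    (hcol : ∀ Y, ∑ X, ‖((sectorSubMatrix L M β Ft).transpose * normalCovariance L M (sym s₀) * sectorSubMatrix L M β Ft) X Y‖ ≤ α)
    {δ : ℝ} (hδ : 0 ≤ δ) (hent : ∀ X Y, ‖((sectorSubMatrix L M β Ft).transpose * normalCovariance L M (sym s₁) * sectorSubMatrix L M β Ft) X Y‖ ≤ δ)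
    (Na Nb : ℕ → ℝ) (hNb0 : ∀ k, 0 ≤ Nb k)
    (hNa : ∀ k ∈ Icc 3 (Fintype.card (HubbardFieldIdx L M × Fin 2) + 2), ∀ σ₀ : Fin (m₀ + 1) → SectorLeg N,
      hubbardSectorKernelNorm L M β F (prescribedTuples univ
        (Fin.append (fun _ : Fin k => (none : Option (SectorLeg N))) (fun j => some (σ₀ j)))) (klE5Carrier L M β μ K n₀ κ V Λ) ≤ Na k)
    (hNb : ∀ k ∈ Icc 3 (Fintype.card (HubbardFieldIdx L M × Fin 2) + 2), ∀ (ω₀ : SectorLeg N) (τ' : Fin 2 → SectorLeg N) (ω₁ : Fin m₁ → SectorLeg N),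
      hubbardSectorKernelNorm L M β F (prescribedTuples univ
        (Fin.append (fun i : Fin k => if h : (i : ℕ) < 3 then some ((Fin.cons ω₀ τ' : Fin 3 → SectorLeg N) ⟨i, h⟩) else none)
          (fun j => some (ω₁ j)))) (klE5Carrier L M β μ K n₀ κ V Λ) ≤ Nb k)
    {x A : ℝ} (hx0 : 0 ≤ x) (hx1 : x < 1) (hA : 0 ≤ A)
    (henv : ∀ k ∈ Icc 3 (Fintype.card (HubbardFieldIdx L M × Fin 2) + 2),
      (∑ t, κg t ^ 2) ^ (k - 3) * ((imagTimeWeight β M * Na k) * (imagTimeWeight β M * Nb k)) ≤ x ^ (k - 3) * A) :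
    ∑ i ∈ Finset.Icc 2 (Fintype.card (HubbardFieldIdx L M × Fin 2) + 1), ((i.factorial : ℝ))⁻¹ *
      ∑ Z ∈ univ.filter (fun Z : Fin 4 → SpaceTimeIdx L M × SectorLeg N => Z p = z ∧ ∀ j, (Z j).2 = Ωo j),
        ‖kernel ℂ ((grassmannLaplacian ℂ (crossCov ℂ ((sectorSubMatrix L M β Ft).transpose *
              (klE5Total L M β μ K n₀ κ - klE5DressedSlice L M β μ K n₀ κ Λ) * sectorSubMatrix L M β Ft)) ^ i *
            grassmannLaplacian ℂ (crossCov ℂ ((sectorSubMatrix L M β Ft).transpose * klE5DressedSliceDeriv L M β μ K n₀ κ Λ *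
              sectorSubMatrix L M β Ft)))
          (dblCopy ℂ 0 (sectorPreimage β F (klE5Carrier L M β μ K n₀ κ V Λ)) *
            dblCopy ℂ 1 (sectorPreimage β F (klE5Carrier L M β μ K n₀ κ V Λ)))) 4 (fun j => (Z j, s j))‖ ≤
      lam⁻¹ * (((m₀ + m₁ + 5).factorial : ℝ) / ((4 : ℕ).factorial * (1 - x) ^ (m₀ + m₁ + 6)) * (α * (δ * ((4 * ρ₀ : ℕ) : ℝ)) ^ 2 * A)) := by
  have hsome : ∀ (ω₀ : SectorLeg N) (τ' : Fin 2 → SectorLeg N),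
      (Fin.cons (some ω₀) (fun j => some (τ' j)) : Fin (2 + 1) → Option (SectorLeg N)) = fun i => some ((Fin.cons ω₀ τ' : Fin 3 → SectorLeg N) i) := by
    intro ω₀ τ'
    funext i
    refine Fin.cases ?_ (fun j => ?_) i
    · rfl
    · simp only [Fin.cons_succ]
  have h := sum_norm_kernel_pow_mul_sectorPreimage_le_gramTailHybrid (e' := 2) (m := 4) (Nm := Fintype.card (HubbardFieldIdx L M × Fin 2) + 1) hβ F Ft
    hρ₀ sym s₀ s₁ κg hκF hκG (klE5Carrier L M β μ K n₀ κ V Λ) (klE5Carrier L M β μ K n₀ κ V Λ) s hm₀ hm₁ p hp z Ωo hα hrow hcol hδ hent Na Nb hNb0 hNa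
    (fun k hk ω₀ τ' σ₁ => by rw [hsome]; exact hNb k hk ω₀ τ' σ₁) hx0 hx1 hA henv
  rw [hs₀, hs₁] at h
  have e1 : m₀ + 1 + m₁ + (2 + 1) + 1 = m₀ + m₁ + 5 := by ring
  have e2 : m₀ + 1 + m₁ + (2 + 1) + 2 = m₀ + m₁ + 6 := by ring
  rw [e1, e2] at h
  -- un-scale line `0`
  simp_rw [kernel_pow_mul_crossLaplacian_smul_line, norm_mul, Complex.norm_real, Real.norm_of_nonneg hlam.le, ← mul_sum] at h
  rw [le_inv_mul_iff₀ hlam]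
  calc lam * ∑ i ∈ Finset.Icc 2 (Fintype.card (HubbardFieldIdx L M × Fin 2) + 1), ((i.factorial : ℝ))⁻¹ * _
      = ∑ i ∈ Finset.Icc 2 (Fintype.card (HubbardFieldIdx L M × Fin 2) + 1), ((i.factorial : ℝ))⁻¹ * (lam * _) := by
        rw [mul_sum]; exact sum_congr rfl fun i _ => by ring
    _ ≤ _ := h

/-- **The same with a RESCALED line `0`, pinned at a leg of copy `1`** (`s p = 1`; roles of the level norms exchanged). [cite: BenfattoGiulianiMastropietro2006, §2.8 (2.80)] -/
theorem klE5_hybridTail_le_of_lineData_scaled_of_b {m₀ m₁ : ℕ} (hβ : 0 ≤ β) (F Ft : Fin N → FreqMomentum L M → ℂ)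
    {ρ₀ : ℕ} (hρ₀ : ∀ ω : Fin N, ((univ : Finset (Fin N)).filter fun ω' => ∃ q, Ft ω q * Ft ω' q ≠ 0).card ≤ ρ₀)
    (sym : ι → FreqMomentum L M × Fin 2 → ℂ) (s₀ s₁ : ι) {lam : ℝ} (hlam : 0 < lam)
    (hs₀ : normalCovariance L M (sym s₀) = (lam : ℂ) • klE5DressedSliceDeriv L M β μ K n₀ κ Λ)
    (hs₁ : normalCovariance L M (sym s₁) = klE5Total L M β μ K n₀ κ - klE5DressedSlice L M β μ K n₀ κ Λ)
    (κg : ι → ℝ)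
    (hκF : ∀ (t : ι) (Y : SpaceTimeIdx L M × SectorLeg N), Y.2.2 = 0 → ‖sectorGramF L M β Ft (sym t) Y‖ ≤ κg t)
    (hκG : ∀ (t : ι) (Y : SpaceTimeIdx L M × SectorLeg N), Y.2.2 = 1 → ‖sectorGramG L M β Ft (sym t) Y‖ ≤ κg t)
    (s : Fin 4 → Fin 2) (hm₀ : (univ.filter fun i => s i = 0).card = m₀) (hm₁ : (univ.filter fun i => s i = 1).card = m₁ + 1)
    (p : Fin 4) (hp : s p = 1) (z : SpaceTimeIdx L M × SectorLeg N) (Ωo : Fin 4 → SectorLeg N) {α : ℝ} (hα : 0 ≤ α)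
    (hrow : ∀ X, ∑ Y, ‖((sectorSubMatrix L M β Ft).transpose * normalCovariance L M (sym s₀) * sectorSubMatrix L M β Ft) X Y‖ ≤ α)
    (hcol : ∀ Y, ∑ X, ‖((sectorSubMatrix L M β Ft).transpose * normalCovariance L M (sym s₀) * sectorSubMatrix L M β Ft) X Y‖ ≤ α)
    {δ : ℝ} (hδ : 0 ≤ δ) (hent : ∀ X Y, ‖((sectorSubMatrix L M β Ft).transpose * normalCovariance L M (sym s₁) * sectorSubMatrix L M β Ft) X Y‖ ≤ δ)
    (Na Nb : ℕ → ℝ) (hNa0 : ∀ k, 0 ≤ Na k)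
    (hNa : ∀ k ∈ Icc 3 (Fintype.card (HubbardFieldIdx L M × Fin 2) + 2), ∀ (ω₀ : SectorLeg N) (σ' : Fin 2 → SectorLeg N) (ω₁ : Fin m₀ → SectorLeg N),
      hubbardSectorKernelNorm L M β F (prescribedTuples univ
        (Fin.append (fun i : Fin k => if h : (i : ℕ) < 3 then some ((Fin.cons ω₀ σ' : Fin 3 → SectorLeg N) ⟨i, h⟩) else none)
          (fun j => some (ω₁ j)))) (klE5Carrier L M β μ K n₀ κ V Λ) ≤ Na k)
    (hNb : ∀ k ∈ Icc 3 (Fintype.card (HubbardFieldIdx L M × Fin 2) + 2), ∀ σ₁ : Fin (m₁ + 1) → SectorLeg N,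
      hubbardSectorKernelNorm L M β F (prescribedTuples univ
        (Fin.append (fun _ : Fin k => (none : Option (SectorLeg N))) (fun j => some (σ₁ j)))) (klE5Carrier L M β μ K n₀ κ V Λ) ≤ Nb k)
    {x A : ℝ} (hx0 : 0 ≤ x) (hx1 : x < 1) (hA : 0 ≤ A)
    (henv : ∀ k ∈ Icc 3 (Fintype.card (HubbardFieldIdx L M × Fin 2) + 2),
      (∑ t, κg t ^ 2) ^ (k - 3) * ((imagTimeWeight β M * Na k) * (imagTimeWeight β M * Nb k)) ≤ x ^ (k - 3) * A) :
    ∑ i ∈ Finset.Icc 2 (Fintype.card (HubbardFieldIdx L M × Fin 2) + 1), ((i.factorial : ℝ))⁻¹ *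
      ∑ Z ∈ univ.filter (fun Z : Fin 4 → SpaceTimeIdx L M × SectorLeg N => Z p = z ∧ ∀ j, (Z j).2 = Ωo j),
        ‖kernel ℂ ((grassmannLaplacian ℂ (crossCov ℂ ((sectorSubMatrix L M β Ft).transpose *
              (klE5Total L M β μ K n₀ κ - klE5DressedSlice L M β μ K n₀ κ Λ) * sectorSubMatrix L M β Ft)) ^ i *
            grassmannLaplacian ℂ (crossCov ℂ ((sectorSubMatrix L M β Ft).transpose * klE5DressedSliceDeriv L M β μ K n₀ κ Λ *
              sectorSubMatrix L M β Ft)))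
          (dblCopy ℂ 0 (sectorPreimage β F (klE5Carrier L M β μ K n₀ κ V Λ)) *
            dblCopy ℂ 1 (sectorPreimage β F (klE5Carrier L M β μ K n₀ κ V Λ)))) 4 (fun j => (Z j, s j))‖ ≤
      lam⁻¹ * (((m₀ + m₁ + 5).factorial : ℝ) / ((4 : ℕ).factorial * (1 - x) ^ (m₀ + m₁ + 6)) * (α * (δ * ((4 * ρ₀ : ℕ) : ℝ)) ^ 2 * A)) := by
  have hsome : ∀ (ω₀ : SectorLeg N) (τ' : Fin 2 → SectorLeg N),
      (Fin.cons (some ω₀) (fun j => some (τ' j)) : Fin (2 + 1) → Option (SectorLeg N)) = fun i => some ((Fin.cons ω₀ τ' : Fin 3 → SectorLeg N) i) := by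
    intro ω₀ τ'
    funext i
    refine Fin.cases ?_ (fun j => ?_) i
    · rfl
    · simp only [Fin.cons_succ]
  have h := sum_norm_kernel_pow_mul_sectorPreimage_le_gramTailHybrid_of_b (e' := 2) (m := 4) (Nm := Fintype.card (HubbardFieldIdx L M × Fin 2) + 1) hβ
    F Ft hρ₀ sym s₀ s₁ κg hκF hκG (klE5Carrier L M β μ K n₀ κ V Λ) (klE5Carrier L M β μ K n₀ κ V Λ) s hm₀ hm₁ p hp z Ωo hα hrow hcol hδ hent Na Nb hNa0
    (fun k hk ω₀ σ' σ₀ => by rw [hsome]; exact hNa k hk ω₀ σ' σ₀) hNb hx0 hx1 hA henv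
  rw [hs₀, hs₁] at h
  have e1 : m₀ + (m₁ + 1) + (2 + 1) + 1 = m₀ + m₁ + 5 := by ring
  have e2 : m₀ + (m₁ + 1) + (2 + 1) + 2 = m₀ + m₁ + 6 := by ring
  rw [e1, e2] at h
  -- un-scale line `0`
  simp_rw [kernel_pow_mul_crossLaplacian_smul_line, norm_mul, Complex.norm_real, Real.norm_of_nonneg hlam.le, ← mul_sum] at h
  rw [le_inv_mul_iff₀ hlam]
  calc lam * ∑ i ∈ Finset.Icc 2 (Fintype.card (HubbardFieldIdx L M × Fin 2) + 1), ((i.factorial : ℝ))⁻¹ * _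
      = ∑ i ∈ Finset.Icc 2 (Fintype.card (HubbardFieldIdx L M × Fin 2) + 1), ((i.factorial : ℝ))⁻¹ * (lam * _) := by
        rw [mul_sum]; exact sum_congr rfl fun i _ => by ring
    _ ≤ _ := h


end Scaled

/-! ## §3 The point-augmented pair with a rescaled line `0` -/

section AugScaled

variable {L M N : ℕ} [NeZero L] (β μ : ℝ) (K : TrigPolyC4v) (n₀ : ℕ) (κ : FreqMomentum L M × Fin 2 → ℂ)
  (V : HubbardGrassmann L M) (Λ : ℝ) (Qm : TorusSite 2 L) (x y : TorusSite 2 L × MatsubaraIdx M) {ι : Type*} [Fintype ι] [DecidableEq ι]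

/-- **The point-augmented tail with a RESCALED line `0`, `m₀ + 1 ≥ 1` legs from copy `0`**, from the OLD line data
(`hrow/hcol/hent` and Gram `κg` w.r.t. `F̃`; every symbol supported in the plateau of `F`; overlap `ρ₀`, multiplicity `ρ₁`) and the carrier's MIXED
level norms w.r.t. the augmented thin family `F⁺ = pointAugment F e` (EXACTLY the prescriptions of `…E5BlockLabels` §2). [cite: BenfattoGiulianiMastropietro2006, §2.8 (2.80)] -/
theorem klE5_hybridTail_le_of_lineData_pointAugment_scaled {m₀ m₁ : ℕ} (hβ : 0 ≤ β) (F Ft : Fin N → FreqMomentum L M → ℂ)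
    {ρ₀ ρ₁ : ℕ} (hρ₀ : ∀ ω : Fin N, ((univ : Finset (Fin N)).filter fun ω' => ∃ q, Ft ω q * Ft ω' q ≠ 0).card ≤ ρ₀)
    (hρ₁ : ∀ k : FreqMomentum L M, ((univ : Finset (Fin N)).filter fun ω => Ft ω k ≠ 0).card ≤ ρ₁)
    (sym : ι → FreqMomentum L M × Fin 2 → ℂ) (s₀ s₁ : ι) (hsym : ∀ t ks, sym t ks ≠ 0 → ∑ ω, F ω ks.1 = 1) {lam : ℝ} (hlam : 0 < lam)
    (hs₀ : normalCovariance L M (sym s₀) = (lam : ℂ) • klE5DressedSliceDeriv L M β μ K n₀ κ Λ)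
    (hs₁ : normalCovariance L M (sym s₁) = klE5Total L M β μ K n₀ κ - klE5DressedSlice L M β μ K n₀ κ Λ)
    (hĊ : ∀ X Y, klE5DressedSliceDeriv L M β μ K n₀ κ Λ X Y ≠ 0 → ∑ ω, F ω X.1.1 = 1 ∧ ∑ ω, F ω Y.1.1 = 1)
    (hD : ∀ X Y, (klE5Total L M β μ K n₀ κ - klE5DressedSlice L M β μ K n₀ κ Λ) X Y ≠ 0 → ∑ ω, F ω X.1.1 = 1 ∧ ∑ ω, F ω Y.1.1 = 1)
    (κg : ι → ℝ) (hκg : ∀ t, 0 ≤ κg t)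
    (hκF : ∀ (t : ι) (Y : SpaceTimeIdx L M × SectorLeg N), Y.2.2 = 0 → ‖sectorGramF L M β Ft (sym t) Y‖ ≤ κg t)
    (hκG : ∀ (t : ι) (Y : SpaceTimeIdx L M × SectorLeg N), Y.2.2 = 1 → ‖sectorGramG L M β Ft (sym t) Y‖ ≤ κg t)
    (s : Fin 4 → Fin 2) (hm₀ : (univ.filter fun i => s i = 0).card = m₀ + 1) (hm₁ : (univ.filter fun i => s i = 1).card = m₁)
    (p : Fin 4) (hp : s p = 0) (z : SpaceTimeIdx L M × SectorLeg (N + 4)) (Ωo : Fin 4 → SectorLeg (N + 4)) {α : ℝ} (hα : 0 ≤ α)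
    (hrow : ∀ X, ∑ Y, ‖((sectorSubMatrix L M β Ft).transpose * normalCovariance L M (sym s₀) * sectorSubMatrix L M β Ft) X Y‖ ≤ α)
    (hcol : ∀ Y, ∑ X, ‖((sectorSubMatrix L M β Ft).transpose * normalCovariance L M (sym s₀) * sectorSubMatrix L M β Ft) X Y‖ ≤ α)
    {δ : ℝ} (hδ : 0 ≤ δ) (hent : ∀ X Y, ‖((sectorSubMatrix L M β Ft).transpose * normalCovariance L M (sym s₁) * sectorSubMatrix L M β Ft) X Y‖ ≤ δ)
    (Na Nb : ℕ → ℝ) (hNb0 : ∀ k, 0 ≤ Nb k)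
    (hNa : ∀ k ∈ Icc 3 (Fintype.card (HubbardFieldIdx L M × Fin 2) + 2), ∀ σ₀ : Fin (m₀ + 1) → SectorLeg (N + 4),
      hubbardSectorKernelNorm L M β (pointAugment F (klE5ExtMomenta Qm x y)) (prescribedTuples univ
        (Fin.append (fun _ : Fin k => (none : Option (SectorLeg (N + 4)))) (fun j => some (σ₀ j)))) (klE5Carrier L M β μ K n₀ κ V Λ) ≤ Na k)
    (hNb : ∀ k ∈ Icc 3 (Fintype.card (HubbardFieldIdx L M × Fin 2) + 2), ∀ (ω₀ : SectorLeg (N + 4)) (τ' : Fin 2 → SectorLeg (N + 4))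
      (ω₁ : Fin m₁ → SectorLeg (N + 4)),
      hubbardSectorKernelNorm L M β (pointAugment F (klE5ExtMomenta Qm x y)) (prescribedTuples univ
        (Fin.append (fun i : Fin k => if h : (i : ℕ) < 3 then some ((Fin.cons ω₀ τ' : Fin 3 → SectorLeg (N + 4)) ⟨i, h⟩) else none)
          (fun j => some (ω₁ j)))) (klE5Carrier L M β μ K n₀ κ V Λ) ≤ Nb k)
    {x' A : ℝ} (hx0 : 0 ≤ x') (hx1 : x' < 1) (hA : 0 ≤ A)
    (henv : ∀ k ∈ Icc 3 (Fintype.card (HubbardFieldIdx L M × Fin 2) + 2),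
      (∑ t, κg t ^ 2) ^ (k - 3) * ((imagTimeWeight β M * Na k) * (imagTimeWeight β M * Nb k)) ≤ x' ^ (k - 3) * A) :
    ∑ i ∈ Finset.Icc 2 (Fintype.card (HubbardFieldIdx L M × Fin 2) + 1), ((i.factorial : ℝ))⁻¹ *
      ∑ Z ∈ univ.filter (fun Z : Fin 4 → SpaceTimeIdx L M × SectorLeg (N + 4) => Z p = z ∧ ∀ j, (Z j).2 = Ωo j),
        ‖kernel ℂ ((grassmannLaplacian ℂ (crossCov ℂ ((sectorSubMatrix L M β (pointAugmentFat F Ft (klE5ExtMomenta Qm x y))).transpose *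
              (klE5Total L M β μ K n₀ κ - klE5DressedSlice L M β μ K n₀ κ Λ) * sectorSubMatrix L M β (pointAugmentFat F Ft (klE5ExtMomenta Qm x y)))) ^ i *
            grassmannLaplacian ℂ (crossCov ℂ ((sectorSubMatrix L M β (pointAugmentFat F Ft (klE5ExtMomenta Qm x y))).transpose *
              klE5DressedSliceDeriv L M β μ K n₀ κ Λ * sectorSubMatrix L M β (pointAugmentFat F Ft (klE5ExtMomenta Qm x y)))))
          (dblCopy ℂ 0 (sectorPreimage β (pointAugment F (klE5ExtMomenta Qm x y)) (klE5Carrier L M β μ K n₀ κ V Λ)) *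
            dblCopy ℂ 1 (sectorPreimage β (pointAugment F (klE5ExtMomenta Qm x y)) (klE5Carrier L M β μ K n₀ κ V Λ)))) 4 (fun j => (Z j, s j))‖ ≤
      lam⁻¹ * (((m₀ + m₁ + 5).factorial : ℝ) / ((4 : ℕ).factorial * (1 - x') ^ (m₀ + m₁ + 6)) * (α * (δ * ((4 * (ρ₀ + ρ₁ + 4) : ℕ) : ℝ)) ^ 2 * A)) := by
  have hĊ' : ∀ X Y, normalCovariance L M (sym s₀) X Y ≠ 0 → ∑ ω, F ω X.1.1 = 1 ∧ ∑ ω, F ω Y.1.1 = 1 := by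
    rw [hs₀]
    intro X Y h
    exact hĊ X Y fun h0 => h (by rw [Matrix.smul_apply, h0, smul_zero])
  have hD' : ∀ X Y, normalCovariance L M (sym s₁) X Y ≠ 0 → ∑ ω, F ω X.1.1 = 1 ∧ ∑ ω, F ω Y.1.1 = 1 := by rw [hs₁]; exact hD
  exact klE5_hybridTail_le_of_lineData_scaled β μ K n₀ κ V Λ hβ (pointAugment F (klE5ExtMomenta Qm x y)) (pointAugmentFat F Ft (klE5ExtMomenta Qm x y))
    (card_filter_overlap_pointAugmentFat_le F Ft _ hρ₀ hρ₁) sym s₀ s₁ hlam hs₀ hs₁ κg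
    (fun t Y hY => norm_sectorGramF_pointAugmentFat_le β F Ft _ (sym t) (hsym t) (hκg t) (hκF t) Y hY)
    (fun t Y hY => norm_sectorGramG_pointAugmentFat_le β F Ft _ (sym t) (hsym t) (hκg t) (hκG t) Y hY)
    s hm₀ hm₁ p hp z Ωo hα
    (rowSum_pullback_pointAugmentFat_le β F Ft _ _ hĊ' hα hrow) (colSum_pullback_pointAugmentFat_le β F Ft _ _ hĊ' hα hcol)
    hδ (entry_pullback_pointAugmentFat_le β F Ft _ _ hD' hδ hent) Na Nb hNb0 hNa hNb hx0 hx1 hA henv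

/-- **The point-augmented tail with a RESCALED line `0`, `m₁ + 1 ≥ 1` legs from copy `1`** (pinned there). [cite: BenfattoGiulianiMastropietro2006, §2.8 (2.80)] -/
theorem klE5_hybridTail_le_of_lineData_pointAugment_scaled_of_b {m₀ m₁ : ℕ} (hβ : 0 ≤ β) (F Ft : Fin N → FreqMomentum L M → ℂ)
    {ρ₀ ρ₁ : ℕ} (hρ₀ : ∀ ω : Fin N, ((univ : Finset (Fin N)).filter fun ω' => ∃ q, Ft ω q * Ft ω' q ≠ 0).card ≤ ρ₀)
    (hρ₁ : ∀ k : FreqMomentum L M, ((univ : Finset (Fin N)).filter fun ω => Ft ω k ≠ 0).card ≤ ρ₁)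
    (sym : ι → FreqMomentum L M × Fin 2 → ℂ) (s₀ s₁ : ι) (hsym : ∀ t ks, sym t ks ≠ 0 → ∑ ω, F ω ks.1 = 1) {lam : ℝ} (hlam : 0 < lam)
    (hs₀ : normalCovariance L M (sym s₀) = (lam : ℂ) • klE5DressedSliceDeriv L M β μ K n₀ κ Λ)
    (hs₁ : normalCovariance L M (sym s₁) = klE5Total L M β μ K n₀ κ - klE5DressedSlice L M β μ K n₀ κ Λ)
    (hĊ : ∀ X Y, klE5DressedSliceDeriv L M β μ K n₀ κ Λ X Y ≠ 0 → ∑ ω, F ω X.1.1 = 1 ∧ ∑ ω, F ω Y.1.1 = 1)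
    (hD : ∀ X Y, (klE5Total L M β μ K n₀ κ - klE5DressedSlice L M β μ K n₀ κ Λ) X Y ≠ 0 → ∑ ω, F ω X.1.1 = 1 ∧ ∑ ω, F ω Y.1.1 = 1)
    (κg : ι → ℝ) (hκg : ∀ t, 0 ≤ κg t)
    (hκF : ∀ (t : ι) (Y : SpaceTimeIdx L M × SectorLeg N), Y.2.2 = 0 → ‖sectorGramF L M β Ft (sym t) Y‖ ≤ κg t)
    (hκG : ∀ (t : ι) (Y : SpaceTimeIdx L M × SectorLeg N), Y.2.2 = 1 → ‖sectorGramG L M β Ft (sym t) Y‖ ≤ κg t)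
    (s : Fin 4 → Fin 2) (hm₀ : (univ.filter fun i => s i = 0).card = m₀) (hm₁ : (univ.filter fun i => s i = 1).card = m₁ + 1)
    (p : Fin 4) (hp : s p = 1) (z : SpaceTimeIdx L M × SectorLeg (N + 4)) (Ωo : Fin 4 → SectorLeg (N + 4)) {α : ℝ} (hα : 0 ≤ α)
    (hrow : ∀ X, ∑ Y, ‖((sectorSubMatrix L M β Ft).transpose * normalCovariance L M (sym s₀) * sectorSubMatrix L M β Ft) X Y‖ ≤ α)
    (hcol : ∀ Y, ∑ X, ‖((sectorSubMatrix L M β Ft).transpose * normalCovariance L M (sym s₀) * sectorSubMatrix L M β Ft) X Y‖ ≤ α)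
    {δ : ℝ} (hδ : 0 ≤ δ) (hent : ∀ X Y, ‖((sectorSubMatrix L M β Ft).transpose * normalCovariance L M (sym s₁) * sectorSubMatrix L M β Ft) X Y‖ ≤ δ)
    (Na Nb : ℕ → ℝ) (hNa0 : ∀ k, 0 ≤ Na k)
    (hNa : ∀ k ∈ Icc 3 (Fintype.card (HubbardFieldIdx L M × Fin 2) + 2), ∀ (ω₀ : SectorLeg (N + 4)) (σ' : Fin 2 → SectorLeg (N + 4))
      (ω₁ : Fin m₀ → SectorLeg (N + 4)),
      hubbardSectorKernelNorm L M β (pointAugment F (klE5ExtMomenta Qm x y)) (prescribedTuples univ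
        (Fin.append (fun i : Fin k => if h : (i : ℕ) < 3 then some ((Fin.cons ω₀ σ' : Fin 3 → SectorLeg (N + 4)) ⟨i, h⟩) else none)
          (fun j => some (ω₁ j)))) (klE5Carrier L M β μ K n₀ κ V Λ) ≤ Na k)
    (hNb : ∀ k ∈ Icc 3 (Fintype.card (HubbardFieldIdx L M × Fin 2) + 2), ∀ σ₁ : Fin (m₁ + 1) → SectorLeg (N + 4),
      hubbardSectorKernelNorm L M β (pointAugment F (klE5ExtMomenta Qm x y)) (prescribedTuples univ
        (Fin.append (fun _ : Fin k => (none : Option (SectorLeg (N + 4)))) (fun j => some (σ₁ j)))) (klE5Carrier L M β μ K n₀ κ V Λ) ≤ Nb k)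
    {x' A : ℝ} (hx0 : 0 ≤ x') (hx1 : x' < 1) (hA : 0 ≤ A)
    (henv : ∀ k ∈ Icc 3 (Fintype.card (HubbardFieldIdx L M × Fin 2) + 2),
      (∑ t, κg t ^ 2) ^ (k - 3) * ((imagTimeWeight β M * Na k) * (imagTimeWeight β M * Nb k)) ≤ x' ^ (k - 3) * A) :
    ∑ i ∈ Finset.Icc 2 (Fintype.card (HubbardFieldIdx L M × Fin 2) + 1), ((i.factorial : ℝ))⁻¹ *
      ∑ Z ∈ univ.filter (fun Z : Fin 4 → SpaceTimeIdx L M × SectorLeg (N + 4) => Z p = z ∧ ∀ j, (Z j).2 = Ωo j),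
        ‖kernel ℂ ((grassmannLaplacian ℂ (crossCov ℂ ((sectorSubMatrix L M β (pointAugmentFat F Ft (klE5ExtMomenta Qm x y))).transpose *
              (klE5Total L M β μ K n₀ κ - klE5DressedSlice L M β μ K n₀ κ Λ) * sectorSubMatrix L M β (pointAugmentFat F Ft (klE5ExtMomenta Qm x y)))) ^ i *
            grassmannLaplacian ℂ (crossCov ℂ ((sectorSubMatrix L M β (pointAugmentFat F Ft (klE5ExtMomenta Qm x y))).transpose *
              klE5DressedSliceDeriv L M β μ K n₀ κ Λ * sectorSubMatrix L M β (pointAugmentFat F Ft (klE5ExtMomenta Qm x y)))))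
          (dblCopy ℂ 0 (sectorPreimage β (pointAugment F (klE5ExtMomenta Qm x y)) (klE5Carrier L M β μ K n₀ κ V Λ)) *
            dblCopy ℂ 1 (sectorPreimage β (pointAugment F (klE5ExtMomenta Qm x y)) (klE5Carrier L M β μ K n₀ κ V Λ)))) 4 (fun j => (Z j, s j))‖ ≤
      lam⁻¹ * (((m₀ + m₁ + 5).factorial : ℝ) / ((4 : ℕ).factorial * (1 - x') ^ (m₀ + m₁ + 6)) * (α * (δ * ((4 * (ρ₀ + ρ₁ + 4) : ℕ) : ℝ)) ^ 2 * A)) := by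
  have hĊ' : ∀ X Y, normalCovariance L M (sym s₀) X Y ≠ 0 → ∑ ω, F ω X.1.1 = 1 ∧ ∑ ω, F ω Y.1.1 = 1 := by
    rw [hs₀]
    intro X Y h
    exact hĊ X Y fun h0 => h (by rw [Matrix.smul_apply, h0, smul_zero])
  have hD' : ∀ X Y, normalCovariance L M (sym s₁) X Y ≠ 0 → ∑ ω, F ω X.1.1 = 1 ∧ ∑ ω, F ω Y.1.1 = 1 := by rw [hs₁]; exact hD
  exact klE5_hybridTail_le_of_lineData_scaled_of_b β μ K n₀ κ V Λ hβ (pointAugment F (klE5ExtMomenta Qm x y)) (pointAugmentFat F Ft (klE5ExtMomenta Qm x y))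
    (card_filter_overlap_pointAugmentFat_le F Ft _ hρ₀ hρ₁) sym s₀ s₁ hlam hs₀ hs₁ κg
    (fun t Y hY => norm_sectorGramF_pointAugmentFat_le β F Ft _ (sym t) (hsym t) (hκg t) (hκF t) Y hY)
    (fun t Y hY => norm_sectorGramG_pointAugmentFat_le β F Ft _ (sym t) (hsym t) (hκg t) (hκG t) Y hY)
    s hm₀ hm₁ p hp z Ωo hα
    (rowSum_pullback_pointAugmentFat_le β F Ft _ _ hĊ' hα hrow) (colSum_pullback_pointAugmentFat_le β F Ft _ _ hĊ' hα hcol)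
    hδ (entry_pullback_pointAugmentFat_le β F Ft _ _ hD' hδ hent) Na Nb hNa0 hNa hNb hx0 hx1 hA henv


end AugScaled

end Summit.HubbardSuperconductivity.HubbardSuperconductivity.Theorems.KLRegimeSplit

end
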